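import Mathlib.Algebra.MvPolynomial.Rename
import Mathlib.Algebra.BigOperators.Ring.Finset
import Mathlib.Algebra.BigOperators.Group.Multiset.Basic
import Mathlib.Data.Fintype.Pi
import Mathlib.Data.Fintype.Prod
import Mathlib.Data.Fintype.BigOperators
import Mathlib.Logic.Function.Basic
import Mathlib.Logic.Equiv.Basic
import Mathlib.GroupTheory.Perm.Basic
import HarnessLib

/-!
# One-sorted (directed, looped) homomorphism polynomials and labelled pattern expressions

Topic `Computability/AlgebraicComplexity`, namespace `Literature.Computability.AlgebraicComplexity`.
Companion of `PatternExpressions.lean` (the BIPARTITE graph algebra: row labels and column labels, the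
language of `Sym_n × Sym_m`-symmetric computation, Dawar–Pago–Seppelt 2025 §5).  For circuits symmetric
under the DIAGONAL action of `Sym_n` on the `n × n` matrix (`x_ij ↦ x_{σ i, σ j}`, Dawar–Wilsenach's
"square-symmetric" circuits) the natural currency is ONE-SORTED: a label is an element of `[n]` used both
as a row and as a column index, patterns are DIRECTED multigraphs with loops, and the homomorphism
polynomial of a pattern `D = (V, E)` is `Σ_{h : V → [n]} Π_{(u,v) ∈ E} x_{h u, h v}` (Dawar–Pago–Seppelt 2025,
Remark p. 17 and Conclusion p. 45: "the polynomials on square matrices symmetric under the `Sym_n` action …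
a complete classification in terms of homomorphism polynomials from directed graphs might be achievable";
Dwivedi–Pago–Seppelt 2026 §1, footnote).  This file provides the DEFINITIONS, mirroring
`PatternExpressions.lean`:

* `diHomPoly E n R` — the homomorphism polynomial of the directed looped multigraph with edge multiset
  `E : Multiset (V × V)`; `rename_perm_diHomPoly` — it is invariant under the diagonal action.
* `DiPatternExpr R k` — ONE-SORTED LABELLED PATTERN EXPRESSIONS with `k` labels: `edge a b` (the variable
  `x_{ℓ a, ℓ b}`; `a = b` is allowed and gives a diagonal variable `x_ii`), constants, sums, products
  (gluing), and `sumLabel a` (summing out label `a`, which may then be reused).  `value n e ℓ` is the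
  semantics at a label assignment `ℓ : Fin k → Fin n`; `close n e = Σ_ℓ value n e ℓ`; `length` counts
  operations.  `rename_value` — EQUIVARIANCE under the diagonal action; `rename_perm_close` — closed
  one-sorted expressions are square-symmetric (diagonally invariant); `value_congr` — the value depends
  only on the labels that occur free; `close_edge_self` — the trace `Σ_i x_ii` is the closed expression
  `edge 0 0` with ONE label (it is not the closed polynomial of any bipartite expression).
* `renameLabels σ e` / `value_renameLabels` — relabelling by a permutation of the labels;
  `subst a b e` / `value_subst` — CAPTURE-AVOIDING identification of label `a` with label `b`
  (`value (subst a b e) ℓ = value e (ℓ[a := ℓ b])`), the syntactic operation behind inclusion–exclusion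
  over label collisions in the extraction of labelled quantities (DPS25 §4).

Everything here is a definition or a proved lemma; nothing is a named fact.
-/

noncomputable section

namespace Literature.Computability.AlgebraicComplexity

open MvPolynomial

universe u v

/-! ### Directed looped homomorphism polynomials -/

/-- **The one-sorted homomorphism polynomial** of the directed looped multigraph pattern with vertex
type `V` and edge multiset `E`, on the `n × n` variable matrix:
`Σ_{h : V → Fin n} Π_{(u,v) ∈ E} x_{h u, h v}`. [cite: DawarPagoSeppelt2025, §7 (Conclusion, p. 45)] -/
def diHomPoly {V : Type u} [Fintype V] [DecidableEq V] (E : Multiset (V × V)) (n : ℕ) (R : Type v)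
    [CommSemiring R] : MvPolynomial (Fin n × Fin n) R :=
  ∑ h : V → Fin n, (E.map fun e => (X (h e.1, h e.2) : MvPolynomial (Fin n × Fin n) R)).prod

/-- **One-sorted homomorphism polynomials are square-symmetric**: renaming `x_ij ↦ x_{σ i, σ j}`
permutes the summands `h ↦ σ ∘ h`. [cite: DawarPagoSeppelt2025, §7 (Conclusion, p. 45)] -/
theorem rename_perm_diHomPoly {V : Type u} [Fintype V] [DecidableEq V] (E : Multiset (V × V)) (n : ℕ)
    (R : Type v) [CommSemiring R] (σ : Equiv.Perm (Fin n)) :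
    rename (fun p : Fin n × Fin n => (σ p.1, σ p.2)) (diHomPoly E n R) = diHomPoly E n R := by
  unfold diHomPoly
  rw [map_sum]
  simp only [map_multiset_prod, Multiset.map_map, Function.comp_def, rename_X]
  exact Fintype.sum_equiv ((Equiv.refl V).arrowCongr σ) _ _ fun h => rfl

/-! ### One-sorted labelled pattern expressions -/

/-- **One-sorted labelled pattern expressions** over constants `R` with `k` labels (the algebra of
directed looped patterns with labelled vertices): `edge a b` (the variable `x_{ℓ a, ℓ b}`, loops allowed),
`const c`, `add`, `mul` (gluing along all labels), `sumLabel a e = Σ_v e[ℓ a := v]` (forgetting a label).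
[cite: DawarPagoSeppelt2025, §5 and §7] -/
inductive DiPatternExpr (R : Type v) (k : ℕ) : Type v
  /-- The edge from label `a` to label `b`: the variable `x_{ℓ a, ℓ b}` (`a = b`: the diagonal variable). -/
  | edge (a b : Fin k) : DiPatternExpr R k
  /-- A constant. -/
  | const (c : R) : DiPatternExpr R k
  /-- Sum of two expressions. -/
  | add (e₁ e₂ : DiPatternExpr R k) : DiPatternExpr R k
  /-- Product (gluing along all labels) of two expressions. -/
  | mul (e₁ e₂ : DiPatternExpr R k) : DiPatternExpr R k
  /-- Summing out the label `a` (it may be reused afterwards). -/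
  | sumLabel (a : Fin k) (e : DiPatternExpr R k) : DiPatternExpr R k

namespace DiPatternExpr

variable {R : Type v} {k : ℕ}

/-- The number of operations of an expression. [cite: DawarPagoSeppelt2025, §5] -/
def length : DiPatternExpr R k → ℕ
  | edge _ _ => 1
  | const _ => 1
  | add e₁ e₂ => e₁.length + e₂.length + 1
  | mul e₁ e₂ => e₁.length + e₂.length + 1
  | sumLabel _ e => e.length + 1

/-- Every expression has positive length. [cite: DawarPagoSeppelt2025, §5] -/
theorem length_pos (e : DiPatternExpr R k) : 0 < e.length := by
  cases e <;> simp [length]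

/-- The labels occurring free in an expression. [cite: DawarPagoSeppelt2025, §5] -/
def freeLabels : DiPatternExpr R k → Finset (Fin k)
  | edge a b => {a, b}
  | const _ => ∅
  | add e₁ e₂ => e₁.freeLabels ∪ e₂.freeLabels
  | mul e₁ e₂ => e₁.freeLabels ∪ e₂.freeLabels
  | sumLabel a e => e.freeLabels.erase a

/-! ### Relabelling and capture-avoiding identification of labels (syntax) -/

/-- **Relabelling by a permutation of the labels** (all occurrences, binders included).
[cite: DawarPagoSeppelt2025, §5] -/
def renameLabels (σ : Equiv.Perm (Fin k)) : DiPatternExpr R k → DiPatternExpr R k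
  | edge a b => edge (σ a) (σ b)
  | const c => const c
  | add e₁ e₂ => add (renameLabels σ e₁) (renameLabels σ e₂)
  | mul e₁ e₂ => mul (renameLabels σ e₁) (renameLabels σ e₂)
  | sumLabel a e => sumLabel (σ a) (renameLabels σ e)

/-- The length is invariant under relabelling. [cite: DawarPagoSeppelt2025, §5] -/
theorem length_renameLabels (σ : Equiv.Perm (Fin k)) (e : DiPatternExpr R k) :
    (renameLabels σ e).length = e.length := by
  induction e with
  | edge a b => rfl
  | const c => rfl
  | add e₁ e₂ ih₁ ih₂ => simp [renameLabels, length, ih₁, ih₂]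
  | mul e₁ e₂ ih₁ ih₂ => simp [renameLabels, length, ih₁, ih₂]
  | sumLabel a e ih => simp [renameLabels, length, ih]

/-- **Capture-avoiding identification of label `a` with label `b`** (`e[a ↦ b]`): the free occurrences of
`a` become `b`; under a binder of `a` nothing changes; a binder of `b` is first swapped with `a` (which is
free for reuse there), so that the outer value of `b` is not captured. [cite: DawarPagoSeppelt2025, §4] -/
def subst (a b : Fin k) : DiPatternExpr R k → DiPatternExpr R k
  | edge c d => edge (if c = a then b else c) (if d = a then b else d)
  | const c => const c
  | add e₁ e₂ => add (subst a b e₁) (subst a b e₂)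
  | mul e₁ e₂ => mul (subst a b e₁) (subst a b e₂)
  | sumLabel c e =>
      if c = a then sumLabel c e
      else if c = b then sumLabel a (renameLabels (Equiv.swap a b) e)
      else sumLabel c (subst a b e)

variable [CommSemiring R]

/-- **Semantics** of a one-sorted expression on the `n × n` variable matrix at the label assignment
`ℓ : Fin k → Fin n`. [cite: DawarPagoSeppelt2025, §5] -/
def value (n : ℕ) : DiPatternExpr R k → (Fin k → Fin n) → MvPolynomial (Fin n × Fin n) R
  | edge a b, ℓ => X (ℓ a, ℓ b)
  | const c, _ => C c
  | add e₁ e₂, ℓ => value n e₁ ℓ + value n e₂ ℓ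
  | mul e₁ e₂, ℓ => value n e₁ ℓ * value n e₂ ℓ
  | sumLabel a e, ℓ => ∑ v : Fin n, value n e (Function.update ℓ a v)

/-- The **closed polynomial** of a one-sorted expression: the sum of its values over all label
assignments. [cite: DawarPagoSeppelt2025, §5] -/
def close (n : ℕ) (e : DiPatternExpr R k) : MvPolynomial (Fin n × Fin n) R :=
  ∑ ℓ : Fin k → Fin n, value n e ℓ

/-- `value` of an edge (defining equation of the semantics). [cite: DawarPagoSeppelt2025, §5] -/
@[simp] theorem value_edge (n : ℕ) (a b : Fin k) (ℓ : Fin k → Fin n) :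
    value n (edge a b : DiPatternExpr R k) ℓ = X (ℓ a, ℓ b) := rfl

/-- `value` of a constant (defining equation of the semantics). [cite: DawarPagoSeppelt2025, §5] -/
@[simp] theorem value_const (n : ℕ) (c : R) (ℓ : Fin k → Fin n) :
    value n (const c : DiPatternExpr R k) ℓ = C c := rfl

/-- `value` of a sum (defining equation of the semantics). [cite: DawarPagoSeppelt2025, §5] -/
@[simp] theorem value_add (n : ℕ) (e₁ e₂ : DiPatternExpr R k) (ℓ : Fin k → Fin n) :
    value n (add e₁ e₂) ℓ = value n e₁ ℓ + value n e₂ ℓ := rfl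

/-- `value` of a product (defining equation of the semantics). [cite: DawarPagoSeppelt2025, §5] -/
@[simp] theorem value_mul (n : ℕ) (e₁ e₂ : DiPatternExpr R k) (ℓ : Fin k → Fin n) :
    value n (mul e₁ e₂) ℓ = value n e₁ ℓ * value n e₂ ℓ := rfl

/-- `value` of a summed-out label (defining equation of the semantics). [cite: DawarPagoSeppelt2025, §5] -/
@[simp] theorem value_sumLabel (n : ℕ) (a : Fin k) (e : DiPatternExpr R k) (ℓ : Fin k → Fin n) :
    value n (sumLabel a e) ℓ = ∑ v : Fin n, value n e (Function.update ℓ a v) := rfl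

/-- **Equivariance of the semantics**: renaming the variables diagonally by `σ` is relabelling the
assignment. [cite: DawarPagoSeppelt2025, §5] -/
theorem rename_value (n : ℕ) (σ : Equiv.Perm (Fin n)) (e : DiPatternExpr R k) :
    ∀ ℓ : Fin k → Fin n,
      rename (fun p : Fin n × Fin n => (σ p.1, σ p.2)) (value n e ℓ) = value n e (σ ∘ ℓ) := by
  induction e with
  | edge a b => intro ℓ; simp [value]
  | const c => intro ℓ; simp [value]
  | add e₁ e₂ ih₁ ih₂ => intro ℓ; simp [value, ih₁, ih₂]
  | mul e₁ e₂ ih₁ ih₂ => intro ℓ; simp [value, ih₁, ih₂]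
  | sumLabel a e ih =>
    intro ℓ
    simp only [value, map_sum, ih, Function.comp_update]
    exact Fintype.sum_equiv σ _ _ fun v => rfl

/-- **Closed one-sorted expressions are square-symmetric** (invariant under the diagonal action).
[cite: DawarPagoSeppelt2025, §5] -/
theorem rename_perm_close (n : ℕ) (σ : Equiv.Perm (Fin n)) (e : DiPatternExpr R k) :
    rename (fun p : Fin n × Fin n => (σ p.1, σ p.2)) (close n e) = close n e := by
  unfold close
  simp only [map_sum, rename_value]
  exact Fintype.sum_equiv ((Equiv.refl (Fin k)).arrowCongr σ) _ _ fun ℓ => rfl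

/-- **The value depends only on the free labels.** [cite: DawarPagoSeppelt2025, §4] -/
theorem value_congr (n : ℕ) (e : DiPatternExpr R k) :
    ∀ ℓ ℓ' : Fin k → Fin n, (∀ a ∈ e.freeLabels, ℓ a = ℓ' a) → value n e ℓ = value n e ℓ' := by
  induction e with
  | edge a b => intro ℓ ℓ' h; simp [value, freeLabels] at h ⊢; rw [h.1, h.2]
  | const c => intro ℓ ℓ' _; rfl
  | add e₁ e₂ ih₁ ih₂ =>
    intro ℓ ℓ' h
    simp only [freeLabels, Finset.mem_union] at h
    rw [value_add, value_add, ih₁ ℓ ℓ' fun a ha => h a (Or.inl ha), ih₂ ℓ ℓ' fun a ha => h a (Or.inr ha)]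
  | mul e₁ e₂ ih₁ ih₂ =>
    intro ℓ ℓ' h
    simp only [freeLabels, Finset.mem_union] at h
    rw [value_mul, value_mul, ih₁ ℓ ℓ' fun a ha => h a (Or.inl ha), ih₂ ℓ ℓ' fun a ha => h a (Or.inr ha)]
  | sumLabel a e ih =>
    intro ℓ ℓ' h
    simp only [value_sumLabel]
    refine Finset.sum_congr rfl fun v _ => ih _ _ fun b hb => ?_
    by_cases hba : b = a
    · subst hba; simp
    · rw [Function.update_of_ne hba, Function.update_of_ne hba]
      exact h b (by simp [freeLabels, hba, hb])

/-- **A value is fixed by every permutation fixing the values of its free labels** (values of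
one-sorted expressions are SUPPORTED on their labels). [cite: DawarPagoSeppelt2025, §4] -/
theorem rename_value_of_fix (n : ℕ) (σ : Equiv.Perm (Fin n)) (e : DiPatternExpr R k) (ℓ : Fin k → Fin n)
    (hσ : ∀ a ∈ e.freeLabels, σ (ℓ a) = ℓ a) :
    rename (fun p : Fin n × Fin n => (σ p.1, σ p.2)) (value n e ℓ) = value n e ℓ := by
  rw [rename_value]
  exact value_congr n e _ _ fun a ha => hσ a ha

/-- **The trace is a closed one-sorted expression with one label**: `close n (edge 0 0) = Σ_i x_ii`
(whereas no closed BIPARTITE expression equals the trace at `n = 2`, `PatternExpr.rename_perm_close`).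
[cite: DawarPagoSeppelt2025, §7 (p. 17 Remark)] -/
theorem close_edge_self (n : ℕ) :
    close n (edge 0 0 : DiPatternExpr R 1) = ∑ i : Fin n, X (i, i) := by
  unfold close
  simp only [value_edge]
  exact Fintype.sum_equiv (Equiv.funUnique (Fin 1) (Fin n)) _ _ fun ℓ => rfl

/-- **One-sorted homomorphism polynomials of labelled patterns are values**: for a pattern on the label
set itself, the product over the edges is the value of the product expression.
[cite: DawarPagoSeppelt2025, §7 (Conclusion, p. 45)] -/
theorem value_edges_prod (n : ℕ) (E : List (Fin k × Fin k)) (ℓ : Fin k → Fin n) :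
    value n ((E.map fun e => (edge e.1 e.2 : DiPatternExpr R k)).foldr mul (const 1)) ℓ =
      (E.map fun e => (X (ℓ e.1, ℓ e.2) : MvPolynomial (Fin n × Fin n) R)).prod := by
  induction E with
  | nil => simp
  | cons e E ih => simp [ih]

/-! ### Relabelling and identification (semantics) -/

/-- Semantics of relabelling: `value (renameLabels σ e) ℓ = value e (ℓ ∘ σ)`. [cite: DawarPagoSeppelt2025, §5] -/
theorem value_renameLabels (n : ℕ) (σ : Equiv.Perm (Fin k)) (e : DiPatternExpr R k) :
    ∀ ℓ : Fin k → Fin n, value n (renameLabels σ e) ℓ = value n e (ℓ ∘ σ) := by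
  induction e with
  | edge a b => intro ℓ; rfl
  | const c => intro ℓ; rfl
  | add e₁ e₂ ih₁ ih₂ => intro ℓ; simp [renameLabels, ih₁, ih₂]
  | mul e₁ e₂ ih₁ ih₂ => intro ℓ; simp [renameLabels, ih₁, ih₂]
  | sumLabel a e ih =>
    intro ℓ
    simp only [renameLabels, value_sumLabel, ih]
    refine Finset.sum_congr rfl fun v _ => congrArg _ (funext fun b => ?_)
    simp only [Function.comp_apply]
    by_cases hb : b = a
    · subst hb; simp
    · rw [Function.update_of_ne hb, Function.update_of_ne (σ.injective.ne hb)]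
      rfl

/-- **Semantics of identification**: `value (e[a ↦ b]) ℓ = value e (ℓ[a := ℓ b])`. [cite: DawarPagoSeppelt2025, §4] -/
theorem value_subst (n : ℕ) (a b : Fin k) (e : DiPatternExpr R k) :
    ∀ ℓ : Fin k → Fin n, value n (subst a b e) ℓ = value n e (Function.update ℓ a (ℓ b)) := by
  induction e with
  | edge c d =>
    intro ℓ
    simp only [subst, value_edge]
    congr 1
    ext
    · by_cases hc : c = a
      · subst hc; simp
      · simp [hc]
    · by_cases hd : d = a
      · subst hd; simp
      · simp [hd]
  | const c => intro ℓ; rfl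
  | add e₁ e₂ ih₁ ih₂ => intro ℓ; simp [subst, ih₁, ih₂]
  | mul e₁ e₂ ih₁ ih₂ => intro ℓ; simp [subst, ih₁, ih₂]
  | sumLabel c e ih =>
    intro ℓ
    by_cases hca : c = a
    · subst hca
      simp only [subst, if_true, value_sumLabel]
      refine Finset.sum_congr rfl fun v _ => ?_
      rw [Function.update_idem]
    · by_cases hcb : c = b
      · subst hcb
        simp only [subst, hca, if_false, if_true, value_sumLabel, value_renameLabels]
        refine Finset.sum_congr rfl fun v _ => ?_
        congr 1
        funext x
        simp only [Function.comp_apply]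
        by_cases hxa : x = a
        · subst hxa
          rw [Equiv.swap_apply_left, Function.update_of_ne hca, Function.update_of_ne (Ne.symm hca),
            Function.update_self]
        · by_cases hxc : x = c
          · subst hxc
            rw [Equiv.swap_apply_right, Function.update_self, Function.update_self]
          · rw [Equiv.swap_apply_of_ne_of_ne hxa hxc, Function.update_of_ne hxa,
              Function.update_of_ne hxc, Function.update_of_ne hxa]
      · simp only [subst, hca, hcb, if_false, value_sumLabel, ih]
        refine Finset.sum_congr rfl fun v _ => ?_
        rw [Function.update_of_ne (Ne.symm hcb), Function.update_comm hca]

end DiPatternExpr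

end Literature.Computability.AlgebraicComplexity

end
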